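import Literature.AlgebraicGeometry.ComplexMultiplication.CMTorusProductsHodgeClassesPohlmann
import Literature.AlgebraicGeometry.ComplexMultiplication.CMTorusHodgeClassesPohlmann
import Literature.Geometry.Kaehler.ComplexTorusPicardNumberPoincareLength
import Literature.NumberTheory.ComplexMultiplication.CMTorusAbelianVarietyOrder
import Literature.NumberTheory.ComplexMultiplication.PartialConjugationOfRealIntersection
import Literature.NumberTheory.ComplexMultiplication.CMFieldConjSquareQuadraticSubfields
import Literature.NumberTheory.ComplexMultiplication.CMTypeCount
import HarnessLib

/-!
# The Picard number of a product of TWO CM tori and the rank of `Hom` between CM tori of two fields: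
# `ρ(B₀ × B₁) = ρ(B₀) + ρ(B₁) + rk Hom_ℚ(B₀, B₁)`, `rk Hom_ℚ(B₀, B₁) = #{(s, t) | τs ∈ Φ₀ ⟺ τt ∈ Φ₁ for all τ}`

Family `hodge`, lane `lit-hodgefound` (Track 2; Layers A3/A4: rows A4-13 «Picard number», A4-07 «Pohlmann», A3.4.14–15
«`Hom` between CM tori», A3.5.5), topic `Literature/AlgebraicGeometry/ComplexMultiplication`, namespaces
`Literature.AlgebraicGeometry.Pohlmann1968` (§1, combinatorics of balanced PAIRS) and
`Literature.AlgebraicGeometry.ComplexMultiplication.CMTorus` (§§2–3).  THEOREMS ONLY (no definition, no named fact; D-0026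
net debt `0`).  Sequel BY NAME of `CMTorusProductsHodgeClassesPohlmann` (row g11-#1: `ρ(∏_i B_i) = #pohlmannSetsAlg Φ 1` for
the product torus of the CM tori `B_i = ℂ^{Φ_i}/u(𝔪_i)` of a family of number fields, `sigmaPiPeriod` carrier), of
`CMTorusHodgeClassesPohlmann` (`ρ(ℂ^Φ/u(𝔪)) = #pohlmannSets Φ 1`, one field) and of
`Geometry/Kaehler/ComplexTorusPicardNumberPoincareLength` (Hulek–Laface: `ρ(∏_k X_k) = Σ_k ρ(X_k) + Σ_{k<l} rk Hom_ℚ(X_k, X_l)`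
for abelian varieties, `ComplexTorus.finrank_neronSeveriGroup_sigmaPi`).

THE PRINTS (held texts).
* K. Hulek, R. Laface, *On the Picard numbers of abelian varieties*, Ann. Sc. Norm. Super. Pisa (5) XIX (2019)
  [HulekLaface2019PicardNumbersAV] (held `paper:arxiv-1703.05882` p0005–p0007), §2.1 **Proposition 2.2** (proof):
  «`NS(A × B) = NS(A) ⊕ NS(B) ⊕ Hom(A, B^∨)` … Hence `Hom(A_i,A_j) = Hom(A_i,A_j^∨) = 0` …», **Corollary 2.3** «Let `A_1, …, A_r`
  be simple abelian varieties, such that `A_i` is not isogenous to `A_j` for `i ≠ j`. Then `ρ(∏ A_i^{n_i}) = Σ ρ(A_i^{n_i})`»,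
  and §1: «This, together with Murty's result, provides us with a theoretical algorithm for computing the Picard number of
  a given abelian variety» — in the tree: `ρ(X₁ × X₂) = ρ(X₁) + ρ(X₂) + dim_ℚ Hom_ℚ(X₁, X₂)` for abelian varieties.
* Z. Gao, E. Ullmo [GaoUllmo2025], Thm. 3.1 "(Pohlmann)" (held `paper:galaxy-pdf-4667137180` p0012): «In particular
  `dim_ℚ Bᵖ(A)` is the number of ordered `P ∈ 𝒫(S)` with `|P| = 2p` satisfying (3.2) `|σP ∩ Φ| = |σP ∩ Φ̄|` for all
  `σ ∈ G`» — for `p = 1` and the CM pair `(K₀ × K₁, Φ₀ ⊔ Φ₁)`: the balanced PAIRS of embeddings of `K₀ × K₁`.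
* B. B. Gordon [Gordon1999HodgeAVSurvey] §9.2 and 9.2.2 (balanced pairs `{φ, ψ}` ↔ divisor classes; «`|τΔ ∩ S| = |τΔ ∩ S̄|`»);
  §3 Theorem (Imai) with its proof («an element of `Gal` that acts as `+1` on … and `−1` on the other components» — the
  partial conjugations of §4), (Murty) and 7.5–7.7 (products).
* G. Shimura [Shimura1998] §7.4 Prop. 15 / §14.1 Prop. 1 (for two abelian varieties of the SAME primitive type
  `Hom(A_𝔞, A_𝔟) ≅ 𝔞⁻¹𝔟`, of rank `[K : ℚ]` — the tree's `CMAbelianVarietyHomGroup`; consistent with the count below, cf.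
  `NOT here`), §8.2 Prop. 26.
* H. Lange [Lange2023AbelianVarietiesComplex] §2.4.4 Thm. 2.4.25 / Cor. 2.4.26 (`Hom` of products blockwise; `Hom(X_ν, X_μ) = 0`
  for non-isogenous simple factors), §1.1.2 Prop. 1.1.6 (the rational representation `ρ_r : Hom_ℚ(X, X') ↪ Hom_ℚ(Λ_ℚ, Λ'_ℚ)`).

THE MECHANISM (finite combinatorics + two printed counts).  For a family of TWO number fields `K₀, K₁` with CM types
`Φ₀, Φ₁` (index type `Fin 2`), a balanced set of size `2` of the CM algebra `K₀ × K₁` — an element of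
`pohlmannSetsAlg Φ 1`, i.e. a pair `{x, y}` of embeddings with `τx ∈ Φ ⟺ τy ∉ Φ` for every `τ ∈ Aut(ℂ)` (§1
`pair_mem_pohlmannSetsAlg_one_iff`) — lies either inside slot `0` (a balanced pair of `Φ₀`), inside slot `1`, or ACROSS the
slots: `{(0, s), (1, t)}` with `τs ∈ Φ₀ ⟺ τt ∉ Φ₁` for all `τ`.  Hence (§1 `ncard_pohlmannSetsAlg_one_fin_two`)
`#pohlmannSetsAlg Φ 1 = #pohlmannSets Φ₀ 1 + #pohlmannSets Φ₁ 1 + #Cross`.  Reading the three Pohlmann counts as Picard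
numbers (`ρ(B₀ × B₁)`, `ρ(B₀)`, `ρ(B₁)`; rows g11-#1 and g8) and comparing with Hulek–Laface's
`ρ(B₀ × B₁) = ρ(B₀) + ρ(B₁) + rk Hom_ℚ(B₀, B₁)` (the CM tori of CM fields are abelian varieties, Shimura §6.2 Thm. 3,
`CMTypeLattice.isAbelianVariety_periodEquiv`) gives **`rk Hom_ℚ(B₀, B₁) = #Cross`** (§3); for a CM field `K₁` the
substitution `t ↦ t̄` turns the cross pairs into the COMPATIBLE pairs `(s, t)` with `τs ∈ Φ₀ ⟺ τt ∈ Φ₁` for all `τ`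
(§2; `τ ∘ t̄ = (τ ∘ t)‾` on a CM field) — the pairs of eigenlines `H¹(B₀)_s`, `H¹(B₁)_t` of the same Hodge type along
every Galois conjugate, i.e. the Galois-descent count of `Hom_{ℚ-HS}(H¹(B₁), H¹(B₀)) ≅ Hom_ℚ(B₀, B₁)` (Deligne–Milne's full
faithfulness of `H¹`; not used in the proofs).

WHAT IS PROVED.
* §1 (`Pohlmann1968`, any `Fin n` family of fields `K_i`, CM types `Φ_i`): `pair_mem_pohlmannSetsAlg_one_iff`,
  `mem_pohlmannSetsAlg_one_iff` (the balanced sets of size two are the pairs `{x, y}` with `τx ∈ Φ ⟺ τy ∉ Φ`), the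
  single-field forms `pair_mem_pohlmannSets_one_iff`, `mem_pohlmannSets_one_iff`, the slot lemma
  `map_sigmaMk_mem_pohlmannSetsAlg_one_iff`, and for `n = 2` **`ncard_pohlmannSetsAlg_one_fin_two`**:
  `#pohlmannSetsAlg Φ 1 = #pohlmannSets Φ₀ 1 + #pohlmannSets Φ₁ 1 + #{(s,t) | ∀ τ, τs ∈ Φ₀ ⟺ τt ∉ Φ₁}`.
* §2 `ncard_crossPairs_eq_ncard_compatiblePairs` — for `K₁` a CM field, `#{(s,t) | ∀ τ, τs ∈ Φ₀ ⟺ τt ∉ Φ₁} =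
  #{(s,t) | ∀ τ, τs ∈ Φ₀ ⟺ τt ∈ Φ₁}` (the bijection `t ↦ t̄`).
* §3 (`CMTorus`, `B_i = ComplexTorus (periodEquiv (Φ i) (μ i))`, `B₀ × B₁ = ComplexTorus (sigmaPiPeriod fun i ↦ periodEquiv (Φ i) (μ i))`):
  **`finrank_neronSeveriGroup_sigmaPiPeriod_fin_two`** — Hulek–Laface for two CM tori that are abelian varieties:
  `ρ(B₀ × B₁) = ρ(B₀) + ρ(B₁) + rk Hom_ℚ(B₀, B₁)`; **`finrank_homRat_periodEquiv_eq_ncard_crossPairs`** —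
  `rk Hom_ℚ(B₀, B₁) = #{(s,t) | ∀ τ, τs ∈ Φ₀ ⟺ τt ∉ Φ₁}` (abelian-variety hypothesis; e.g. CM fields); for CM FIELDS
  **`finrank_homRat_periodEquiv_eq_ncard`** — `rk Hom_ℚ(B₀, B₁) = #{(s,t) ∈ Hom(K₀,ℂ) × Hom(K₁,ℂ) | ∀ τ, τs ∈ Φ₀ ⟺ τt ∈ Φ₁}`,
  its mirror `finrank_homRat_periodEquiv_eq_ncard'` (`Hom_ℚ(B₁, B₀)`, same number), the isogeny-class form
  `finrank_homRat_eq_ncard_of_isIsogenous` (`X ∼ B₀`, `Y ∼ B₁`), the vanishing criterion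
  **`finrank_homRat_periodEquiv_eq_zero_iff`** (`Hom_ℚ(B₀, B₁) = 0 ⟺` no compatible pair `(s, t)`), and the explicit
  Picard number **`finrank_neronSeveriGroup_sigmaPiPeriod_fin_two_eq`**:
  `ρ(B₀ × B₁) = #pohlmannSets Φ₀ 1 + #pohlmannSets Φ₁ 1 + #{compatible pairs}`.
* §3 (pairwise, any `Fin n` family of CM fields, via the `Fin 2` sub-family `(K_k, K_l)`):
  **`finrank_homRat_periodEquiv_eq_ncard_pairwise`** — `rk Hom_ℚ(B_k, B_l) = #{(s,t) | ∀ τ, τs ∈ Φ_k ⟺ τt ∈ Φ_l}` (for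
  `k = l`: `dim_ℚ End_ℚ(B_k)`); **`finrank_neronSeveriGroup_sigmaPiPeriod_eq_sum`** —
  `ρ(∏_i B_i) = Σ_i #pohlmannSets Φ_i 1 + Σ_{k<l} #{compatible pairs of (Φ_k, Φ_l)}`; and the resulting combinatorial
  identity `ncard_pohlmannSetsAlg_one_eq_sum` for `#pohlmannSetsAlg Φ 1`.
* §4 `Hom`-ORTHOGONALITY CRITERIA (two CM fields, all types and lattices): `compatiblePairs_eq_empty_of_partialConj` (a
  `σ ∈ Aut(ℂ)` that is complex conjugation on the embeddings of `K₀` and the identity on those of `K₁` kills every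
  compatible pair: Imai's argument, Gordon §3), **`finrank_homRat_periodEquiv_eq_zero_of_partialConj`**,
  **`finrank_homRat_periodEquiv_eq_zero_of_conj_apply_eq`** — if complex conjugation fixes `L₀ ∩ L₁` pointwise
  (`L_i ⊂ ℂ` the Galois closure of `K_i`; «the Galois closures meet in a totally real field») then `Hom_ℚ(B₀, B₁) = 0`
  (the tree's gluing lemma `forall_exists_partialConj_pair`, Lang VI Thm. 1.14), the cases
  `…_eq_zero_of_odd_finrank` (`[L₀ ∩ L₁ : ℚ]` odd) and `…_eq_zero_of_inf_eq_bot` (linearly disjoint closures),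
  `not_isIsogenous_periodEquiv_of_conj_apply_eq`, and Hulek–Laface's Cor. 2.3 made explicit:
  **`finrank_neronSeveriGroup_sigmaPiPeriod_fin_two_eq_add_of_conj_apply_eq`** — `ρ(B₀ × B₁) = #pohlmannSets Φ₀ 1 + #pohlmannSets Φ₁ 1`.
* §5 VALIDATION `n = 1` (two imaginary quadratic fields `K₀`, `K₁`; `E_i = ℂ/u(𝔪_i)`): `conj_apply_eq_of_finrank_eq_two`
  (`K₀ ≇ K₁` ⟹ complex conjugation fixes `L₀ ∩ L₁`: `L_i = s_i(K_i)` quadratic), hence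
  **`finrank_homRat_periodEquiv_eq_zero_of_finrank_eq_two`** (`Hom_ℚ(E₀, E₁) = 0`),
  `not_isIsogenous_periodEquiv_of_finrank_eq_two`, **`finrank_neronSeveriGroup_sigmaPiPeriod_eq_two_of_finrank_eq_two`**
  (`ρ(E₀ × E₁) = 2`); and for `K₀ ≅ K₁`: `ncard_compatiblePairs_eq_two_of_finrank_eq_two` (the compatible pairs are
  `(φ₀, φ₁)`, `(φ̄₀, φ̄₁)`), **`finrank_homRat_periodEquiv_eq_two_of_finrank_eq_two`** (`rk Hom_ℚ(E₀, E₁) = 2 = [K : ℚ]`,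
  Shimura §7.4 Prop. 15 for `n = 1`) and **`finrank_neronSeveriGroup_sigmaPiPeriod_eq_four_of_finrank_eq_two`** (`ρ = 4`).

NOT here: the evaluation of the count for pairs of fields of higher degree (same primitive type: `[K : ℚ]`, Shimura §7.4
Prop. 15 — the tree's `CMAbelianVarietyHomGroup` on the algebraic carrier — and partially shared CM subfields).

## References
* [HulekLaface2019PicardNumbersAV] K. Hulek, R. Laface, Ann. Sc. Norm. Super. Pisa (5) XIX (2019) — §2.1 Prop. 2.2, Cor. 2.3, §1.
* [GaoUllmo2025] Z. Gao, E. Ullmo, J. Inst. Math. Jussieu 25 (2025) — Thm. 3.1 (with proof).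
* [Pohlmann1968] H. Pohlmann, Ann. of Math. (2) 88 (1968) — Thm. 1.
* [Gordon1999HodgeAVSurvey] B. B. Gordon, CRM Monogr. 10 (1999) — §3, 7.5–7.7, §9.2, 9.2.2.
* [Shimura1998] G. Shimura (1998) — §6.2 Thm. 3, §7.4 Prop. 15, §8.2 Prop. 26, §14.1 Prop. 1.
* [Lange2023AbelianVarietiesComplex] H. Lange (2023) — §1.1.2 Prop. 1.1.6, §2.4.4 Thm. 2.4.25 / Cor. 2.4.26, §1.3.4 Exercise (10)(b).
* [Lang2002] S. Lang, *Algebra*, GTM 211 (2002) — VI §1 Thm. 1.14 (through the tree's `PartialConjugationOfRealIntersection`).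
* [DeligneMilne1982Tannakian] P. Deligne, J. S. Milne, LNM 900 (1982) — II Thm. 6.20 (context only).

## Provenance
Lane `lit-hodgefound`, prover seat `lit-hodgefound-p29` (generation 11), self-proposed row g11-#2; consumes BY NAME
`CMTorusProductsHodgeClassesPohlmann` (`CMTorus.finrank_neronSeveriGroup_sigmaPiPeriod_eq_ncard_pohlmannSetsAlg`),
`CMTorusHodgeClassesPohlmann` (`CMTorus.finrank_neronSeveriGroup_eq_ncard_pohlmannSets`), `Geometry/Kaehler/ComplexTorusPicardNumberPoincareLength`
(`ComplexTorus.finrank_neronSeveriGroup_sigmaPi`), `…/ComplexTorusPicardNumberProduct` (`finrank_homRat_comm_of_isAbelianVariety`),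
`…/ComplexTorusHomRankEquality` (`IsIsogenous.finrank_homRat_eq_left/right`), `…/ComplexTorusEndomorphismAlgebraProduct`
(`not_isIsogenous_of_homRat_eq_bot`), `NumberTheory/…/CMTorusAbelianVarietyOrder` (`CMTypeLattice.isAbelianVariety_periodEquiv`),
`NumberTheory/…/PartialConjugationOfRealIntersection` (`forall_exists_partialConj_pair[_of_odd_finrank]`),
`Pohlmann1968/HodgeClassesCMAlgebra` / `HodgeClassesCMType` (`pohlmannSetsAlg`, `pohlmannSets` and their unfoldings),
`NumberTheory/…/CMTypeCount` (`single`, `eq_conjugate_of_ne`, `exists_eq_single`), `…/CMFieldConjSquareQuadraticSubfields`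
(`normalClosure_eq_fieldRange_of_normal`, `finrank_normalClosure_of_normal`), `Kaehler/ComplexTorusPoincareCompleteReducibility`
(`isSimple_of_card_eq_two`), Mathlib `IsCMField.complexEmbedding_complexConj`, `IntermediateField.finrank_bot_mul_relfinrank`,
`AlgHom.equivFieldRange`.
-/

noncomputable section

open scoped Classical
open NumberField Module

namespace Literature.AlgebraicGeometry.Pohlmann1968

open Literature.AlgebraicGeometry.Motives (CMType)

/-! ## §1 Balanced PAIRS of a CM algebra: `{x, y} ∈ pohlmannSetsAlg Φ 1 ⟺ (τx ∈ Φ ⟺ τy ∉ Φ)`; two slots -/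

section PairLemmas

/-- `#{z ∈ {x, y} | Q z}` as a sum of two indicators (plumbing). [folklore] -/
private theorem ncard_sep_pair_eq {X : Type*} [DecidableEq X] {x y : X} (hxy : x ≠ y) (Q : X → Prop)
    [DecidablePred Q] :
    {z | z ∈ ({x, y} : Finset X) ∧ Q z}.ncard = (if Q x then 1 else 0) + (if Q y then 1 else 0) := by
  have h : {z | z ∈ ({x, y} : Finset X) ∧ Q z} = ↑(({x, y} : Finset X).filter Q) := by
    ext z
    simp only [Set.mem_setOf_eq, Finset.coe_filter]
  rw [h, Set.ncard_coe_finset, Finset.filter_insert, Finset.filter_singleton]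
  by_cases hx : Q x <;> by_cases hy : Q y <;> simp [hx, hy, hxy]

variable {n : ℕ} {K : Fin n → Type} [∀ i, Field (K i)] (Φ : ∀ i, CMType (K i))

/-- **A pair `{x, y}` of embeddings of the CM algebra `∏_i K_i` is balanced (indexes a line of `B¹ ⊗ ℂ` on the product)
iff for every `τ ∈ Aut(ℂ)` exactly one of `τ ∘ x`, `τ ∘ y` lies in the type** («`|σP ∩ Φ| = |σP ∩ Φ̄|`» for `|P| = 2`).
[cite: GaoUllmo2025, Thm. 3.1 (3.2)] [cite: Gordon1999HodgeAVSurvey, §9.2 (9.2.1) and 9.2.2] -/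
theorem pair_mem_pohlmannSetsAlg_one_iff {x y : (i : Fin n) × (K i →+* ℂ)} (hxy : x ≠ y) :
    ({x, y} : Finset ((i : Fin n) × (K i →+* ℂ))) ∈ pohlmannSetsAlg Φ 1 ↔
      ∀ τ : ℂ ≃+* ℂ, ((τ : ℂ →+* ℂ).comp x.2 ∈ (Φ x.1).1 ↔ (τ : ℂ →+* ℂ).comp y.2 ∉ (Φ y.1).1) := by
  rw [mem_pohlmannSetsAlg_iff, Finset.card_pair hxy, isGaloisBalancedAlg_iff]
  simp only [mul_one, true_and]
  refine forall_congr' fun τ => ?_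
  rw [ncard_sep_pair_eq hxy (fun z : (i : Fin n) × (K i →+* ℂ) => (τ : ℂ →+* ℂ).comp z.2 ∈ (Φ z.1).1),
    ncard_sep_pair_eq hxy (fun z : (i : Fin n) × (K i →+* ℂ) => (τ : ℂ →+* ℂ).comp z.2 ∉ (Φ z.1).1)]
  by_cases hx : (τ : ℂ →+* ℂ).comp x.2 ∈ (Φ x.1).1 <;> by_cases hy : (τ : ℂ →+* ℂ).comp y.2 ∈ (Φ y.1).1 <;>
    simp [hx, hy]

/-- **The balanced sets of size two are the pairs `{x, y}`, `x ≠ y`, with `τx ∈ Φ ⟺ τy ∉ Φ` for all `τ`.**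
[cite: GaoUllmo2025, Thm. 3.1] [cite: Gordon1999HodgeAVSurvey, 9.2.2] -/
theorem mem_pohlmannSetsAlg_one_iff {S : Finset ((i : Fin n) × (K i →+* ℂ))} :
    S ∈ pohlmannSetsAlg Φ 1 ↔ ∃ x y, x ≠ y ∧ S = {x, y} ∧
      ∀ τ : ℂ ≃+* ℂ, ((τ : ℂ →+* ℂ).comp x.2 ∈ (Φ x.1).1 ↔ (τ : ℂ →+* ℂ).comp y.2 ∉ (Φ y.1).1) := by
  constructor
  · intro h
    have h2 : S.card = 2 := by rw [(mem_pohlmannSetsAlg_iff.1 h).1]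
    obtain ⟨x, y, hxy, rfl⟩ := Finset.card_eq_two.1 h2
    exact ⟨x, y, hxy, rfl, (pair_mem_pohlmannSetsAlg_one_iff Φ hxy).1 h⟩
  · rintro ⟨x, y, hxy, rfl, h⟩
    exact (pair_mem_pohlmannSetsAlg_one_iff Φ hxy).2 h

variable {K₁ : Type} [Field K₁] (Φ₁ : CMType K₁)

/-- One field: `{s, t} ∈ pohlmannSets Φ 1 ⟺ (τs ∈ Φ ⟺ τt ∉ Φ)` for every `τ` (Gordon 9.2.2's divisor pairs, without the
primitivity used by the tree's `mem_pohlmannSets_one_iff_of_primitive`). [cite: Gordon1999HodgeAVSurvey, §9.2 (9.2.1) and 9.2.2] -/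
theorem pair_mem_pohlmannSets_one_iff {s t : K₁ →+* ℂ} (hst : s ≠ t) :
    ({s, t} : Finset (K₁ →+* ℂ)) ∈ pohlmannSets Φ₁ 1 ↔
      ∀ τ : ℂ ≃+* ℂ, ((τ : ℂ →+* ℂ).comp s ∈ Φ₁.1 ↔ (τ : ℂ →+* ℂ).comp t ∉ Φ₁.1) := by
  rw [mem_pohlmannSets_iff, Finset.card_pair hst, isGaloisBalanced_iff]
  simp only [mul_one, true_and]
  refine forall_congr' fun τ => ?_
  rw [ncard_sep_pair_eq hst (fun u : K₁ →+* ℂ => (τ : ℂ →+* ℂ).comp u ∈ Φ₁.1),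
    ncard_sep_pair_eq hst (fun u : K₁ →+* ℂ => (τ : ℂ →+* ℂ).comp u ∉ Φ₁.1)]
  by_cases hs : (τ : ℂ →+* ℂ).comp s ∈ Φ₁.1 <;> by_cases ht : (τ : ℂ →+* ℂ).comp t ∈ Φ₁.1 <;> simp [hs, ht]

/-- One field: the balanced sets of size two are the pairs `{s, t}`, `s ≠ t`, with `τs ∈ Φ ⟺ τt ∉ Φ` for all `τ`.
[cite: Gordon1999HodgeAVSurvey, 9.2.2] -/
theorem mem_pohlmannSets_one_iff {Δ : Finset (K₁ →+* ℂ)} :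
    Δ ∈ pohlmannSets Φ₁ 1 ↔ ∃ s t, s ≠ t ∧ Δ = {s, t} ∧
      ∀ τ : ℂ ≃+* ℂ, ((τ : ℂ →+* ℂ).comp s ∈ Φ₁.1 ↔ (τ : ℂ →+* ℂ).comp t ∉ Φ₁.1) := by
  constructor
  · intro h
    have h2 : Δ.card = 2 := by rw [(mem_pohlmannSets_iff.1 h).1]
    obtain ⟨s, t, hst, rfl⟩ := Finset.card_eq_two.1 h2
    exact ⟨s, t, hst, rfl, (pair_mem_pohlmannSets_one_iff Φ₁ hst).1 h⟩
  · rintro ⟨s, t, hst, rfl, h⟩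
    exact (pair_mem_pohlmannSets_one_iff Φ₁ hst).2 h

/-- Slot embedding of a pair: `{s, t} ↦ {(k, s), (k, t)}` (plumbing). [folklore] -/
private theorem map_sigmaMk_pair (k : Fin n) (s t : K k →+* ℂ) :
    ({s, t} : Finset (K k →+* ℂ)).map (Function.Embedding.sigmaMk (β := fun i => K i →+* ℂ) k) =
      ({⟨k, s⟩, ⟨k, t⟩} : Finset ((i : Fin n) × (K i →+* ℂ))) := by
  rw [Finset.map_insert, Finset.map_singleton]
  rfl

/-- **A pair inside the slot `k` is balanced for the family iff it is a balanced pair of `Φ_k`** (pull-back along the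
projection `∏_i B_i → B_k`). [cite: Gordon1999HodgeAVSurvey, 9.2.2] [cite: GaoUllmo2025, Thm. 3.1] -/
theorem map_sigmaMk_mem_pohlmannSetsAlg_one_iff (k : Fin n) (Δ : Finset (K k →+* ℂ)) :
    Δ.map (Function.Embedding.sigmaMk (β := fun i => K i →+* ℂ) k) ∈ pohlmannSetsAlg Φ 1 ↔
      Δ ∈ pohlmannSets (Φ k) 1 := by
  rw [mem_pohlmannSets_one_iff, mem_pohlmannSetsAlg_one_iff]
  constructor
  · rintro ⟨x, y, hxy, hS, h⟩
    have hx : x ∈ Δ.map (Function.Embedding.sigmaMk (β := fun i => K i →+* ℂ) k) := by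
      rw [hS]; exact Finset.mem_insert_self _ _
    have hy : y ∈ Δ.map (Function.Embedding.sigmaMk (β := fun i => K i →+* ℂ) k) := by
      rw [hS]; exact Finset.mem_insert_of_mem (Finset.mem_singleton_self _)
    obtain ⟨s, hs, rfl⟩ := Finset.mem_map.1 hx
    obtain ⟨t, ht, rfl⟩ := Finset.mem_map.1 hy
    have hst : s ≠ t := fun h' => hxy (by rw [h'])
    refine ⟨s, t, hst, ?_, h⟩
    apply Finset.map_injective (Function.Embedding.sigmaMk (β := fun i => K i →+* ℂ) k)
    rw [hS, map_sigmaMk_pair]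
    rfl
  · rintro ⟨s, t, hst, rfl, h⟩
    exact ⟨⟨k, s⟩, ⟨k, t⟩, fun h' => hst (eq_of_heq (Sigma.mk.inj h').2), map_sigmaMk_pair k s t, h⟩

end PairLemmas

section TwoSlots

variable {K : Fin 2 → Type} [∀ i, Field (K i)] [∀ i, NumberField (K i)] (Φ : ∀ i, CMType (K i))

/-- **The balanced pairs of a family of two types split into the pairs inside slot `0`, the pairs inside slot `1`, and the
CROSS pairs `{(0, s), (1, t)}` with `τs ∈ Φ₀ ⟺ τt ∉ Φ₁` for all `τ`**:
`#pohlmannSetsAlg Φ 1 = #pohlmannSets Φ₀ 1 + #pohlmannSets Φ₁ 1 + #{(s, t) | ∀ τ, τs ∈ Φ₀ ⟺ τt ∉ Φ₁}` — on `B₀ × B₁`: the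
divisor classes pulled back from the two factors and the classes of Künneth type `(1,1)` («`NS(A × B) = NS(A) ⊕ NS(B) ⊕ Hom(A, B^∨)`»).
[cite: GaoUllmo2025, Thm. 3.1] [cite: HulekLaface2019PicardNumbersAV, §2.1 Prop. 2.2 (proof)] [cite: Gordon1999HodgeAVSurvey, 9.2.2] -/
theorem ncard_pohlmannSetsAlg_one_fin_two :
    (pohlmannSetsAlg Φ 1).ncard = (pohlmannSets (Φ 0) 1).ncard + (pohlmannSets (Φ 1) 1).ncard +
      {q : (K 0 →+* ℂ) × (K 1 →+* ℂ) |
        ∀ τ : ℂ ≃+* ℂ, ((τ : ℂ →+* ℂ).comp q.1 ∈ (Φ 0).1 ↔ (τ : ℂ →+* ℂ).comp q.2 ∉ (Φ 1).1)}.ncard := by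
  -- the three injections: slot `0`, slot `1`, cross pairs
  set X := (i : Fin 2) × (K i →+* ℂ) with hX
  set F₀ : Finset (K 0 →+* ℂ) → Finset X := fun Δ => Δ.map (Function.Embedding.sigmaMk (β := fun i => K i →+* ℂ) 0)
    with hF₀
  set F₁ : Finset (K 1 →+* ℂ) → Finset X := fun Δ => Δ.map (Function.Embedding.sigmaMk (β := fun i => K i →+* ℂ) 1)
    with hF₁
  set G : (K 0 →+* ℂ) × (K 1 →+* ℂ) → Finset X := fun q => ({⟨0, q.1⟩, ⟨1, q.2⟩} : Finset X) with hG
  set C := {q : (K 0 →+* ℂ) × (K 1 →+* ℂ) |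
      ∀ τ : ℂ ≃+* ℂ, ((τ : ℂ →+* ℂ).comp q.1 ∈ (Φ 0).1 ↔ (τ : ℂ →+* ℂ).comp q.2 ∉ (Φ 1).1)} with hC
  have h01 : (0 : Fin 2) ≠ 1 := Fin.zero_ne_one
  have hF₀inj : Function.Injective F₀ := fun Δ Δ' h => Finset.map_injective _ h
  have hF₁inj : Function.Injective F₁ := fun Δ Δ' h => Finset.map_injective _ h
  have hGinj : Function.Injective G := by
    intro q q' h
    have h1 : (⟨0, q.1⟩ : X) ∈ G q' := by rw [← h]; exact Finset.mem_insert_self _ _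
    have h2 : (⟨1, q.2⟩ : X) ∈ G q' := by rw [← h]; exact Finset.mem_insert_of_mem (Finset.mem_singleton_self _)
    simp only [hG, Finset.mem_insert, Finset.mem_singleton, Sigma.mk.inj_iff, h01, h01.symm, false_and, or_false,
      false_or, true_and, heq_eq_eq] at h1 h2
    exact Prod.ext h1 h2
  have hF₀fst : ∀ Δ, ∀ z ∈ F₀ Δ, z.1 = 0 := by
    intro Δ z hz
    obtain ⟨s, -, rfl⟩ := Finset.mem_map.1 hz
    rfl
  have hF₁fst : ∀ Δ, ∀ z ∈ F₁ Δ, z.1 = 1 := by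
    intro Δ z hz
    obtain ⟨s, -, rfl⟩ := Finset.mem_map.1 hz
    rfl
  have hG0 : ∀ q, (⟨0, q.1⟩ : X) ∈ G q := fun q => Finset.mem_insert_self _ _
  have hG1 : ∀ q, (⟨1, q.2⟩ : X) ∈ G q := fun q => Finset.mem_insert_of_mem (Finset.mem_singleton_self _)
  -- the decomposition of the balanced pairs
  have hdecomp : pohlmannSetsAlg Φ 1 = (F₀ '' pohlmannSets (Φ 0) 1 ∪ F₁ '' pohlmannSets (Φ 1) 1) ∪ G '' C := by
    ext S
    constructor
    · intro hS
      obtain ⟨⟨i, s⟩, ⟨j, t⟩, hxy, rfl, h⟩ := (mem_pohlmannSetsAlg_one_iff Φ).1 hS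
      have hi : i = 0 ∨ i = 1 := Fin.exists_fin_two.mp ⟨i, rfl⟩
      have hj : j = 0 ∨ j = 1 := Fin.exists_fin_two.mp ⟨j, rfl⟩
      rcases hi with rfl | rfl <;> rcases hj with rfl | rfl
      · refine Or.inl (Or.inl ⟨{s, t}, ?_, map_sigmaMk_pair 0 s t⟩)
        have hst : s ≠ t := fun h' => hxy (by rw [h'])
        exact (pair_mem_pohlmannSets_one_iff (Φ 0) hst).2 h
      · exact Or.inr ⟨(s, t), h, rfl⟩
      · refine Or.inr ⟨(t, s), fun τ => ?_, ?_⟩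
        · have := h τ
          tauto
        · change ({⟨0, t⟩, ⟨1, s⟩} : Finset X) = {⟨1, s⟩, ⟨0, t⟩}
          exact Finset.pair_comm _ _
      · refine Or.inl (Or.inr ⟨{s, t}, ?_, map_sigmaMk_pair 1 s t⟩)
        have hst : s ≠ t := fun h' => hxy (by rw [h'])
        exact (pair_mem_pohlmannSets_one_iff (Φ 1) hst).2 h
    · rintro ((⟨Δ, hΔ, rfl⟩ | ⟨Δ, hΔ, rfl⟩) | ⟨q, hq, rfl⟩)
      · exact (map_sigmaMk_mem_pohlmannSetsAlg_one_iff Φ 0 Δ).2 hΔ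
      · exact (map_sigmaMk_mem_pohlmannSetsAlg_one_iff Φ 1 Δ).2 hΔ
      · have hne : (⟨0, q.1⟩ : X) ≠ ⟨1, q.2⟩ := fun h' => h01 (congrArg Sigma.fst h')
        exact (pair_mem_pohlmannSetsAlg_one_iff Φ hne).2 hq
  -- disjointness of the three images (read off the slots)
  have hd01 : Disjoint (F₀ '' pohlmannSets (Φ 0) 1) (F₁ '' pohlmannSets (Φ 1) 1) := by
    refine Set.disjoint_left.2 ?_
    rintro _ ⟨Δ, hΔ, rfl⟩ ⟨Δ', hΔ', hEq⟩
    obtain ⟨s, t, hst, rfl, -⟩ := (mem_pohlmannSets_one_iff (Φ 0)).1 hΔ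
    have hmem : (⟨0, s⟩ : X) ∈ F₁ Δ' := by
      rw [hEq]; exact Finset.mem_map_of_mem _ (Finset.mem_insert_self _ _)
    exact h01 (hF₁fst Δ' _ hmem)
  have hd0G : Disjoint (F₀ '' pohlmannSets (Φ 0) 1 ∪ F₁ '' pohlmannSets (Φ 1) 1) (G '' C) := by
    refine Set.disjoint_left.2 ?_
    rintro S (⟨Δ, hΔ, rfl⟩ | ⟨Δ, hΔ, rfl⟩) ⟨q, hq, hEq⟩
    · exact h01.symm (hF₀fst Δ _ (hEq ▸ hG1 q))
    · exact h01 (hF₁fst Δ _ (hEq ▸ hG0 q))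
  rw [hdecomp, Set.ncard_union_eq hd0G, Set.ncard_union_eq hd01, Set.ncard_image_of_injective _ hF₀inj,
    Set.ncard_image_of_injective _ hF₁inj, Set.ncard_image_of_injective _ hGinj]

/-! ## §2 For a CM field `K₁`: cross pairs `t ↦ t̄` compatible pairs -/

/-- On a CM field, `τ ∘ t̄ = (τ ∘ t)‾` for every `τ ∈ Aut(ℂ)` (both are `x ↦ τ(t(ρ x))` for the complex conjugation `ρ` of
the field; re-proof of the tree's `Pohlmann1968.comp_conjugate_eq` to keep the imports light). [cite: Shimura1998, §5.1 Lemma 3 and §8.1 Prop. 25] -/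
private theorem comp_conjugate_eq' {L : Type} [Field L] [NumberField L] [IsCMField L] (τ : ℂ ≃+* ℂ) (t : L →+* ℂ) :
    (τ : ℂ →+* ℂ).comp (ComplexEmbedding.conjugate t) = ComplexEmbedding.conjugate ((τ : ℂ →+* ℂ).comp t) := by
  refine RingHom.ext fun x => ?_
  rw [RingHom.comp_apply, ComplexEmbedding.conjugate_coe_eq, ComplexEmbedding.conjugate_coe_eq,
    ← IsCMField.complexEmbedding_complexConj L t, ← IsCMField.complexEmbedding_complexConj L ((τ : ℂ →+* ℂ).comp t),
    RingHom.comp_apply]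

omit [∀ i, NumberField (K i)] in
/-- `φ̄ ∈ Φ ⟺ φ ∉ Φ` for a CM type `Φ` (`Φ ⊔ Φ̄ = Hom(K, ℂ)`). [folklore] -/
private theorem conjugate_mem_iff (i : Fin 2) (φ : K i →+* ℂ) :
    ComplexEmbedding.conjugate φ ∈ (Φ i).1 ↔ φ ∉ (Φ i).1 := by
  have h1 := (Φ i).2 φ
  have h2 := (Φ i).2 (ComplexEmbedding.conjugate φ)
  rw [show ComplexEmbedding.conjugate (ComplexEmbedding.conjugate φ) = φ from
    ComplexEmbedding.involutive_conjugate (K i) φ] at h2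
  tauto

/-- **Cross pairs versus compatible pairs**: for `K₁` a CM field, `t ↦ t̄` is a bijection
`{(s, t) | ∀ τ, τs ∈ Φ₀ ⟺ τt ∉ Φ₁} ≃ {(s, t) | ∀ τ, τs ∈ Φ₀ ⟺ τt ∈ Φ₁}` (`τ ∘ t̄ = (τ ∘ t)‾` and `ū ∈ Φ₁ ⟺ u ∉ Φ₁`), so
the two sets have the same number of elements. [cite: Shimura1998, §8.1 Prop. 25 and §5.1 Lemma 3] [cite: Gordon1999HodgeAVSurvey, 9.2.2] -/
theorem ncard_crossPairs_eq_ncard_compatiblePairs [IsCMField (K 1)] :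
    {q : (K 0 →+* ℂ) × (K 1 →+* ℂ) |
        ∀ τ : ℂ ≃+* ℂ, ((τ : ℂ →+* ℂ).comp q.1 ∈ (Φ 0).1 ↔ (τ : ℂ →+* ℂ).comp q.2 ∉ (Φ 1).1)}.ncard =
      {q : (K 0 →+* ℂ) × (K 1 →+* ℂ) |
        ∀ τ : ℂ ≃+* ℂ, ((τ : ℂ →+* ℂ).comp q.1 ∈ (Φ 0).1 ↔ (τ : ℂ →+* ℂ).comp q.2 ∈ (Φ 1).1)}.ncard := by
  set f : (K 0 →+* ℂ) × (K 1 →+* ℂ) → (K 0 →+* ℂ) × (K 1 →+* ℂ) := fun q => (q.1, ComplexEmbedding.conjugate q.2)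
    with hf
  have hfinv : ∀ q, f (f q) = q := fun q => by
    simp only [hf, ComplexEmbedding.involutive_conjugate (K 1) q.2]
  have hfinj : Function.Injective f := fun q q' h => by rw [← hfinv q, ← hfinv q', h]
  have hstep : ∀ (q : (K 0 →+* ℂ) × (K 1 →+* ℂ)) (τ : ℂ ≃+* ℂ),
      ((τ : ℂ →+* ℂ).comp (f q).2 ∈ (Φ 1).1 ↔ (τ : ℂ →+* ℂ).comp q.2 ∉ (Φ 1).1) := fun q τ => by
    change (τ : ℂ →+* ℂ).comp (ComplexEmbedding.conjugate q.2) ∈ (Φ 1).1 ↔ _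
    rw [comp_conjugate_eq', conjugate_mem_iff Φ 1]
  have himage : f '' {q : (K 0 →+* ℂ) × (K 1 →+* ℂ) |
        ∀ τ : ℂ ≃+* ℂ, ((τ : ℂ →+* ℂ).comp q.1 ∈ (Φ 0).1 ↔ (τ : ℂ →+* ℂ).comp q.2 ∉ (Φ 1).1)} =
      {q : (K 0 →+* ℂ) × (K 1 →+* ℂ) |
        ∀ τ : ℂ ≃+* ℂ, ((τ : ℂ →+* ℂ).comp q.1 ∈ (Φ 0).1 ↔ (τ : ℂ →+* ℂ).comp q.2 ∈ (Φ 1).1)} := by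
    ext p
    constructor
    · rintro ⟨q, hq, rfl⟩ τ
      have h1 := hq τ
      have h2 := hstep q τ
      change (τ : ℂ →+* ℂ).comp q.1 ∈ (Φ 0).1 ↔ _
      tauto
    · intro hp
      refine ⟨f p, fun τ => ?_, hfinv p⟩
      have h1 := hp τ
      have h2 := hstep p τ
      change (τ : ℂ →+* ℂ).comp p.1 ∈ (Φ 0).1 ↔ _
      tauto
  rw [← himage, Set.ncard_image_of_injective _ hfinj]

omit [∀ i, NumberField (K i)] in
/-- **A partial conjugation kills every compatible pair**: if some `σ ∈ Aut(ℂ)` is complex conjugation on every embedding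
of `K₀` and the identity on every embedding of `K₁`, then NO pair `(s, t)` has `τs ∈ Φ₀ ⟺ τt ∈ Φ₁` for all `τ` (at `τ = 1`
and `τ = σ`: `s ∈ Φ₀ ⟺ t ∈ Φ₁ ⟺ s̄ ∈ Φ₀`, absurd).  [cite: Gordon1999HodgeAVSurvey, §3 Theorem (Imai; proof: «an element
that acts as +1 on one factor and as complex conjugation on the other»)] -/
theorem compatiblePairs_eq_empty_of_partialConj {σ : ℂ ≃+* ℂ}
    (h₀ : ∀ s : K 0 →+* ℂ, (σ : ℂ →+* ℂ).comp s = ComplexEmbedding.conjugate s)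
    (h₁ : ∀ t : K 1 →+* ℂ, (σ : ℂ →+* ℂ).comp t = t) :
    {q : (K 0 →+* ℂ) × (K 1 →+* ℂ) |
        ∀ τ : ℂ ≃+* ℂ, ((τ : ℂ →+* ℂ).comp q.1 ∈ (Φ 0).1 ↔ (τ : ℂ →+* ℂ).comp q.2 ∈ (Φ 1).1)} = ∅ := by
  ext q
  simp only [Set.mem_setOf_eq, Set.mem_empty_iff_false, iff_false]
  intro h
  have hσ := h σ
  have h1 := h 1
  rw [h₀, h₁, conjugate_mem_iff Φ 0] at hσ
  have e₁ : ((1 : ℂ ≃+* ℂ) : ℂ →+* ℂ).comp q.1 = q.1 := RingHom.ext fun _ => rfl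
  have e₂ : ((1 : ℂ ≃+* ℂ) : ℂ →+* ℂ).comp q.2 = q.2 := RingHom.ext fun _ => rfl
  rw [e₁, e₂] at h1
  tauto

end TwoSlots

end Literature.AlgebraicGeometry.Pohlmann1968

/-! ## §3 `ρ(B₀ × B₁) = ρ(B₀) + ρ(B₁) + rk Hom_ℚ(B₀, B₁)` and the `Hom`-rank of a pair of CM tori -/

namespace Literature.AlgebraicGeometry.ComplexMultiplication

open Literature.AlgebraicGeometry.Motives (CMType)
open Literature.AlgebraicGeometry.Pohlmann1968
open Literature.Geometry.Kaehler
open Literature.Geometry.Kaehler.ComplexTorus (IsIsogenous IsAbelianVariety sigmaPiPeriod homRat neronSeveriGroup)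
open Literature.NumberTheory.ComplexMultiplication (CMTypeLattice.isAbelianVariety_periodEquiv
  forall_exists_partialConj_pair forall_exists_partialConj_pair_of_odd_finrank ringEquiv_smul_def)

namespace CMTorus

-- Convention of the CM-torus files (`CMTorusEigenRows`): the real structure of `ℂ^X` is the restriction of scalars of its
-- complex structure, chosen over the pointwise one by instance search.
attribute [local instance high] instModuleRealPiComplex instNormedSpaceRealPiComplex

section Pair

variable {K : Fin 2 → Type} [∀ i, Field (K i)] [∀ i, NumberField (K i)] {ι : Fin 2 → Type} [∀ i, Fintype (ι i)]
  [∀ i, DecidableEq (ι i)] (Φ : ∀ i, CMType (K i)) (μ : ∀ i, Basis (ι i) ℚ (K i))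

/-- The cross term of Hulek–Laface's sum for two factors: `Σ_l Σ_k [k < l] h(k,l) = h(0,1)` over `Fin 2`. [folklore] -/
private theorem sum_sum_ite_lt_fin_two (h : Fin 2 → Fin 2 → ℕ) :
    (∑ l : Fin 2, ∑ k : Fin 2, if k < l then h k l else 0) = h 0 1 := by
  rw [Fin.sum_univ_two, Fin.sum_univ_two, Fin.sum_univ_two]
  simp

/-- **Hulek–Laface for the product of two CM tori that are abelian varieties: `ρ(B₀ × B₁) = ρ(B₀) + ρ(B₁) + rk Hom_ℚ(B₀, B₁)`**
(the tree's `finrank_neronSeveriGroup_sigmaPi` — «`NS(A × B) = NS(A) ⊕ NS(B) ⊕ Hom(A, B^∨)`», `B^∨ ≅ B` up to isogeny — for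
the `Fin 2` family). [cite: HulekLaface2019PicardNumbersAV, §2.1 Prop. 2.2 (proof) and Cor. 2.3] -/
theorem finrank_neronSeveriGroup_sigmaPiPeriod_fin_two (hA : ∀ i, IsAbelianVariety (periodEquiv (Φ i) (μ i))) :
    finrank ℤ (neronSeveriGroup (sigmaPiPeriod fun i => periodEquiv (Φ i) (μ i))) =
      finrank ℤ (neronSeveriGroup (periodEquiv (Φ 0) (μ 0))) + finrank ℤ (neronSeveriGroup (periodEquiv (Φ 1) (μ 1))) +
        finrank ℚ (homRat (periodEquiv (Φ 0) (μ 0)) (periodEquiv (Φ 1) (μ 1))) := by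
  rw [ComplexTorus.finrank_neronSeveriGroup_sigmaPi (fun i => periodEquiv (Φ i) (μ i)) hA,
    sum_sum_ite_lt_fin_two (fun k l => finrank ℚ (homRat (periodEquiv (Φ k) (μ k)) (periodEquiv (Φ l) (μ l)))),
    Fin.sum_univ_two]

/-- **`rk Hom_ℚ(B₀, B₁) = #{(s, t) ∈ Hom(K₀, ℂ) × Hom(K₁, ℂ) | ∀ τ ∈ Aut(ℂ), τs ∈ Φ₀ ⟺ τt ∉ Φ₁}`** for the CM tori
`B_i = ℂ^{Φ_i}/u(𝔪_i)` of two number fields whose tori are abelian varieties (e.g. CM fields, Shimura §6.2 Thm. 3): compare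
`ρ(B₀ × B₁) = ρ(B₀) + ρ(B₁) + rk Hom_ℚ(B₀, B₁)` (Hulek–Laface) with the three Pohlmann counts `ρ(B₀ × B₁) = #pohlmannSetsAlg Φ 1`,
`ρ(B_i) = #pohlmannSets Φ_i 1` and the splitting of the balanced pairs (`ncard_pohlmannSetsAlg_one_fin_two`).
[cite: HulekLaface2019PicardNumbersAV, §2.1 Prop. 2.2 (proof) and §1] [cite: GaoUllmo2025, Thm. 3.1] [cite: Gordon1999HodgeAVSurvey, 9.2.2] -/
theorem finrank_homRat_periodEquiv_eq_ncard_crossPairs (hA : ∀ i, IsAbelianVariety (periodEquiv (Φ i) (μ i))) :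
    finrank ℚ (homRat (periodEquiv (Φ 0) (μ 0)) (periodEquiv (Φ 1) (μ 1))) =
      {q : (K 0 →+* ℂ) × (K 1 →+* ℂ) |
        ∀ τ : ℂ ≃+* ℂ, ((τ : ℂ →+* ℂ).comp q.1 ∈ (Φ 0).1 ↔ (τ : ℂ →+* ℂ).comp q.2 ∉ (Φ 1).1)}.ncard := by
  have h := finrank_neronSeveriGroup_sigmaPiPeriod_fin_two Φ μ hA
  rw [finrank_neronSeveriGroup_sigmaPiPeriod_eq_ncard_pohlmannSetsAlg Φ μ, ncard_pohlmannSetsAlg_one_fin_two Φ,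
    finrank_neronSeveriGroup_eq_ncard_pohlmannSets (Φ 0) (μ 0), finrank_neronSeveriGroup_eq_ncard_pohlmannSets (Φ 1) (μ 1)] at h
  omega

variable [∀ i, IsCMField (K i)]

/-- **THE `Hom`-RANK OF A PAIR OF CM TORI OF CM FIELDS: `rk Hom_ℚ(ℂ^{Φ₀}/u(𝔪₀), ℂ^{Φ₁}/u(𝔪₁)) =
#{(s, t) ∈ Hom(K₀, ℂ) × Hom(K₁, ℂ) | τ ∘ s ∈ Φ₀ ⟺ τ ∘ t ∈ Φ₁ for every τ ∈ Aut(ℂ)}`** — the number of pairs of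
embeddings of the SAME Hodge type along all Galois conjugates (the eigenline pairs `H¹(B₀)_s ⊗ H¹(B₁)_{t̄}` of Künneth type
`(1,1)` on `B₀ × B₁` that survive Galois descent: «`NS(A × B) = NS(A) ⊕ NS(B) ⊕ Hom(A, B^∨)`» with Pohlmann's count of
`NS(B₀ × B₁) ⊗ ℚ`).  The CM tori of CM fields are abelian varieties (`CMTypeLattice.isAbelianVariety_periodEquiv`).
[cite: HulekLaface2019PicardNumbersAV, §2.1 Prop. 2.2 (proof) and §1] [cite: GaoUllmo2025, Thm. 3.1]
[cite: Shimura1998, §6.2 Thm. 3 and §8.1 Prop. 25] [cite: Gordon1999HodgeAVSurvey, 9.2.2] -/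
theorem finrank_homRat_periodEquiv_eq_ncard :
    finrank ℚ (homRat (periodEquiv (Φ 0) (μ 0)) (periodEquiv (Φ 1) (μ 1))) =
      {q : (K 0 →+* ℂ) × (K 1 →+* ℂ) |
        ∀ τ : ℂ ≃+* ℂ, ((τ : ℂ →+* ℂ).comp q.1 ∈ (Φ 0).1 ↔ (τ : ℂ →+* ℂ).comp q.2 ∈ (Φ 1).1)}.ncard := by
  rw [finrank_homRat_periodEquiv_eq_ncard_crossPairs Φ μ fun i => CMTypeLattice.isAbelianVariety_periodEquiv (Φ i) (μ i),
    ncard_crossPairs_eq_ncard_compatiblePairs Φ]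

/-- **… and `rk Hom_ℚ(B₁, B₀)` is the same number** (`rk Hom(X, Y) = rk Hom(Y, X)` for abelian varieties,
`finrank_homRat_comm_of_isAbelianVariety`). [cite: HulekLaface2019PicardNumbersAV, §2.1 Prop. 2.2 (proof)]
[cite: Lange2023AbelianVarietiesComplex, §2.4.4 Cor. 2.4.26] -/
theorem finrank_homRat_periodEquiv_eq_ncard' :
    finrank ℚ (homRat (periodEquiv (Φ 1) (μ 1)) (periodEquiv (Φ 0) (μ 0))) =
      {q : (K 0 →+* ℂ) × (K 1 →+* ℂ) |
        ∀ τ : ℂ ≃+* ℂ, ((τ : ℂ →+* ℂ).comp q.1 ∈ (Φ 0).1 ↔ (τ : ℂ →+* ℂ).comp q.2 ∈ (Φ 1).1)}.ncard := by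
  rw [← ComplexTorus.finrank_homRat_comm_of_isAbelianVariety (CMTypeLattice.isAbelianVariety_periodEquiv (Φ 0) (μ 0))
    (CMTypeLattice.isAbelianVariety_periodEquiv (Φ 1) (μ 1)), finrank_homRat_periodEquiv_eq_ncard]

/-- **Every `X ∼ B₀`, `Y ∼ B₁`: `rk Hom_ℚ(X, Y)` is the number of compatible pairs** (`rk Hom_ℚ` is an isogeny invariant in
both arguments, `IsIsogenous.finrank_homRat_eq_left/right`). [cite: Lange2023AbelianVarietiesComplex, §1.1.2 Prop. 1.1.6 and §2.4.4 Cor. 2.4.26]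
[cite: HulekLaface2019PicardNumbersAV, §2.1 Prop. 2.2 (proof)] -/
theorem finrank_homRat_eq_ncard_of_isIsogenous {ι₀ ι₁ : Type} [Fintype ι₀] [Fintype ι₁] [DecidableEq ι₀] [DecidableEq ι₁]
    {E₀ E₁ : Type} [NormedAddCommGroup E₀] [NormedSpace ℂ E₀] [NormedAddCommGroup E₁] [NormedSpace ℂ E₁]
    {P : (ι₀ → ℝ) ≃L[ℝ] E₀} {Q : (ι₁ → ℝ) ≃L[ℝ] E₁} (hP : IsIsogenous P (periodEquiv (Φ 0) (μ 0)))
    (hQ : IsIsogenous Q (periodEquiv (Φ 1) (μ 1))) :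
    finrank ℚ (homRat P Q) =
      {q : (K 0 →+* ℂ) × (K 1 →+* ℂ) |
        ∀ τ : ℂ ≃+* ℂ, ((τ : ℂ →+* ℂ).comp q.1 ∈ (Φ 0).1 ↔ (τ : ℂ →+* ℂ).comp q.2 ∈ (Φ 1).1)}.ncard := by
  rw [hP.finrank_homRat_eq_left Q, ComplexTorus.IsIsogenous.finrank_homRat_eq_right _ hQ, finrank_homRat_periodEquiv_eq_ncard]

/-- **Vanishing criterion: `Hom_ℚ(B₀, B₁) = 0` iff NO pair of embeddings `(s, t)` has `τs ∈ Φ₀ ⟺ τt ∈ Φ₁` for all `τ`**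
(e.g. the CM tori of two CM fields no conjugates of which share a CM subfield on which the types agree are `Hom`-orthogonal,
so that `ρ(B₀ × B₁) = ρ(B₀) + ρ(B₁)`, Hulek–Laface Cor. 2.3). [cite: HulekLaface2019PicardNumbersAV, §2.1 Prop. 2.2 and Cor. 2.3]
[cite: Gordon1999HodgeAVSurvey, §3 Theorem (Imai) and 9.2.2] -/
theorem finrank_homRat_periodEquiv_eq_zero_iff :
    finrank ℚ (homRat (periodEquiv (Φ 0) (μ 0)) (periodEquiv (Φ 1) (μ 1))) = 0 ↔
      ∀ (s : K 0 →+* ℂ) (t : K 1 →+* ℂ),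
        ∃ τ : ℂ ≃+* ℂ, ¬ ((τ : ℂ →+* ℂ).comp s ∈ (Φ 0).1 ↔ (τ : ℂ →+* ℂ).comp t ∈ (Φ 1).1) := by
  rw [finrank_homRat_periodEquiv_eq_ncard, Set.ncard_eq_zero, Set.eq_empty_iff_forall_notMem]
  constructor
  · intro h s t
    have hst := h (s, t)
    simp only [Set.mem_setOf_eq, not_forall] at hst
    exact hst
  · intro h q hq
    obtain ⟨τ, hτ⟩ := h q.1 q.2
    exact hτ (hq τ)

/-- **The Picard number of the product of two CM tori of CM fields, explicitly:
`ρ(ℂ^{Φ₀}/u(𝔪₀) × ℂ^{Φ₁}/u(𝔪₁)) = #pohlmannSets Φ₀ 1 + #pohlmannSets Φ₁ 1 + #{compatible pairs (s, t)}`** (`ρ(B_i)` the balanced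
pairs of `Φ_i`, e.g. `dim B_i` for a primitive type, `CMTorus.finrank_neronSeveriGroup_eq_of_isPrimitive`; the cross term
`rk Hom_ℚ(B₀, B₁)`). [cite: HulekLaface2019PicardNumbersAV, §2.1 Prop. 2.2 and Cor. 2.3] [cite: GaoUllmo2025, Thm. 3.1] -/
theorem finrank_neronSeveriGroup_sigmaPiPeriod_fin_two_eq :
    finrank ℤ (neronSeveriGroup (sigmaPiPeriod fun i => periodEquiv (Φ i) (μ i))) =
      (pohlmannSets (Φ 0) 1).ncard + (pohlmannSets (Φ 1) 1).ncard +
        {q : (K 0 →+* ℂ) × (K 1 →+* ℂ) |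
          ∀ τ : ℂ ≃+* ℂ, ((τ : ℂ →+* ℂ).comp q.1 ∈ (Φ 0).1 ↔ (τ : ℂ →+* ℂ).comp q.2 ∈ (Φ 1).1)}.ncard := by
  rw [finrank_neronSeveriGroup_sigmaPiPeriod_fin_two Φ μ fun i => CMTypeLattice.isAbelianVariety_periodEquiv (Φ i) (μ i),
    finrank_neronSeveriGroup_eq_ncard_pohlmannSets (Φ 0) (μ 0), finrank_neronSeveriGroup_eq_ncard_pohlmannSets (Φ 1) (μ 1),
    finrank_homRat_periodEquiv_eq_ncard]

/-! ## §4 `Hom`-orthogonality criteria: partial conjugations; Galois closures meeting in a totally real field -/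

/-- **A partial conjugation forces `Hom_ℚ(B₀, B₁) = 0`** — whatever the CM types `Φ₀`, `Φ₁` and the lattices.
[cite: Gordon1999HodgeAVSurvey, §3 Theorem (Imai, proof)] [cite: HulekLaface2019PicardNumbersAV, §2.1 Prop. 2.2] -/
theorem finrank_homRat_periodEquiv_eq_zero_of_partialConj {σ : ℂ ≃+* ℂ}
    (h₀ : ∀ s : K 0 →+* ℂ, (σ : ℂ →+* ℂ).comp s = ComplexEmbedding.conjugate s)
    (h₁ : ∀ t : K 1 →+* ℂ, (σ : ℂ →+* ℂ).comp t = t) :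
    finrank ℚ (homRat (periodEquiv (Φ 0) (μ 0)) (periodEquiv (Φ 1) (μ 1))) = 0 := by
  rw [finrank_homRat_periodEquiv_eq_ncard, compatiblePairs_eq_empty_of_partialConj Φ h₀ h₁, Set.ncard_empty]

/-- **CM tori of two CM fields whose Galois closures `L₀, L₁ ⊂ ℂ` MEET IN A TOTALLY REAL FIELD (complex conjugation fixes
`L₀ ∩ L₁` pointwise) are `Hom`-orthogonal: `Hom_ℚ(ℂ^{Φ₀}/u(𝔪₀), ℂ^{Φ₁}/u(𝔪₁)) = 0` for ALL CM types and lattices** (a partial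
conjugation exists, the tree's `forall_exists_partialConj_pair`).  [cite: Gordon1999HodgeAVSurvey, §3 Theorem (Imai, proof)]
[cite: Lang2002, VI §1 Thm. 1.14] [cite: HulekLaface2019PicardNumbersAV, §2.1 Prop. 2.2 and Cor. 2.3] -/
theorem finrank_homRat_periodEquiv_eq_zero_of_conj_apply_eq
    (hreal : ∀ x : ℂ, x ∈ IntermediateField.normalClosure ℚ (K 0) ℂ → x ∈ IntermediateField.normalClosure ℚ (K 1) ℂ → starRingEnd ℂ x = x) :
    finrank ℚ (homRat (periodEquiv (Φ 0) (μ 0)) (periodEquiv (Φ 1) (μ 1))) = 0 := by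
  obtain ⟨σ, hσ₀, hσ₁⟩ := forall_exists_partialConj_pair (K := K) (i₀ := (0 : Fin 2)) (i₁ := 1) Fin.zero_ne_one
    (fun j => Fin.exists_fin_two.mp ⟨j, rfl⟩) hreal 0
  refine finrank_homRat_periodEquiv_eq_zero_of_partialConj Φ μ (σ := σ) (fun s => ?_) fun t => ?_
  · have h := hσ₀ s
    rw [ringEquiv_smul_def, ringEquiv_smul_def, RingEquiv.toRingHom_eq_coe] at h
    rw [h]
    exact RingHom.ext fun _ => rfl
  · have h := hσ₁ 1 (by decide) t
    rwa [ringEquiv_smul_def, RingEquiv.toRingHom_eq_coe] at h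

/-- **… in particular when `[L₀ ∩ L₁ : ℚ]` is odd** (a normal field of odd degree is totally real), **e.g. when the Galois
closures are linearly disjoint (`L₀ ∩ L₁ = ℚ`)**. [cite: Gordon1999HodgeAVSurvey, §3 Theorem (Imai, proof)]
[cite: HulekLaface2019PicardNumbersAV, §2.1 Cor. 2.3] -/
theorem finrank_homRat_periodEquiv_eq_zero_of_odd_finrank
    (hodd : Odd (finrank ℚ ↥(IntermediateField.normalClosure ℚ (K 0) ℂ ⊓ IntermediateField.normalClosure ℚ (K 1) ℂ))) :
    finrank ℚ (homRat (periodEquiv (Φ 0) (μ 0)) (periodEquiv (Φ 1) (μ 1))) = 0 := by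
  obtain ⟨σ, hσ₀, hσ₁⟩ := forall_exists_partialConj_pair_of_odd_finrank (K := K) (i₀ := (0 : Fin 2)) (i₁ := 1)
    Fin.zero_ne_one (fun j => Fin.exists_fin_two.mp ⟨j, rfl⟩) hodd 0
  refine finrank_homRat_periodEquiv_eq_zero_of_partialConj Φ μ (σ := σ) (fun s => ?_) fun t => ?_
  · have h := hσ₀ s
    rw [ringEquiv_smul_def, ringEquiv_smul_def, RingEquiv.toRingHom_eq_coe] at h
    rw [h]
    exact RingHom.ext fun _ => rfl
  · have h := hσ₁ 1 (by decide) t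
    rwa [ringEquiv_smul_def, RingEquiv.toRingHom_eq_coe] at h

/-- **Linearly disjoint Galois closures: `Hom_ℚ(B₀, B₁) = 0`.** [cite: Gordon1999HodgeAVSurvey, §3 Theorem (Imai, proof)]
[cite: HulekLaface2019PicardNumbersAV, §2.1 Cor. 2.3] -/
theorem finrank_homRat_periodEquiv_eq_zero_of_inf_eq_bot
    (hbot : IntermediateField.normalClosure ℚ (K 0) ℂ ⊓ IntermediateField.normalClosure ℚ (K 1) ℂ = ⊥) :
    finrank ℚ (homRat (periodEquiv (Φ 0) (μ 0)) (periodEquiv (Φ 1) (μ 1))) = 0 := by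
  refine finrank_homRat_periodEquiv_eq_zero_of_conj_apply_eq Φ μ fun x h₀ h₁ => ?_
  have hx : x ∈ (⊥ : IntermediateField ℚ ℂ) := by
    rw [← hbot]
    exact ⟨h₀, h₁⟩
  rw [IntermediateField.mem_bot] at hx
  obtain ⟨q, rfl⟩ := hx
  rw [eq_ratCast]
  exact map_ratCast (starRingEnd ℂ) q

/-- **… hence such tori are NOT isogenous** (`Hom_ℚ = 0` excludes an isogeny, Lange Cor. 1.1.16), and
**`ρ(B₀ × B₁) = ρ(B₀) + ρ(B₁) = #pohlmannSets Φ₀ 1 + #pohlmannSets Φ₁ 1`** (Hulek–Laface Cor. 2.3 for this pair).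
[cite: Lange2023AbelianVarietiesComplex, §1.1.2 Cor. 1.1.16] [cite: HulekLaface2019PicardNumbersAV, §2.1 Cor. 2.3] -/
theorem not_isIsogenous_periodEquiv_of_conj_apply_eq
    (hreal : ∀ x : ℂ, x ∈ IntermediateField.normalClosure ℚ (K 0) ℂ → x ∈ IntermediateField.normalClosure ℚ (K 1) ℂ → starRingEnd ℂ x = x) :
    ¬ IsIsogenous (periodEquiv (Φ 0) (μ 0)) (periodEquiv (Φ 1) (μ 1)) := by
  haveI : Nonempty (ι 0) := (μ 0).index_nonempty
  exact ComplexTorus.not_isIsogenous_of_homRat_eq_bot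
    (Submodule.finrank_eq_zero.1 (finrank_homRat_periodEquiv_eq_zero_of_conj_apply_eq Φ μ hreal))

/-- **`ρ(B₀ × B₁) = #pohlmannSets Φ₀ 1 + #pohlmannSets Φ₁ 1` when the Galois closures meet in a totally real field.**
[cite: HulekLaface2019PicardNumbersAV, §2.1 Cor. 2.3] [cite: GaoUllmo2025, Thm. 3.1] -/
theorem finrank_neronSeveriGroup_sigmaPiPeriod_fin_two_eq_add_of_conj_apply_eq
    (hreal : ∀ x : ℂ, x ∈ IntermediateField.normalClosure ℚ (K 0) ℂ → x ∈ IntermediateField.normalClosure ℚ (K 1) ℂ → starRingEnd ℂ x = x) :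
    finrank ℤ (neronSeveriGroup (sigmaPiPeriod fun i => periodEquiv (Φ i) (μ i))) =
      (pohlmannSets (Φ 0) 1).ncard + (pohlmannSets (Φ 1) 1).ncard := by
  rw [finrank_neronSeveriGroup_sigmaPiPeriod_fin_two Φ μ fun i => CMTypeLattice.isAbelianVariety_periodEquiv (Φ i) (μ i),
    finrank_neronSeveriGroup_eq_ncard_pohlmannSets (Φ 0) (μ 0), finrank_neronSeveriGroup_eq_ncard_pohlmannSets (Φ 1) (μ 1),
    finrank_homRat_periodEquiv_eq_zero_of_conj_apply_eq Φ μ hreal, add_zero]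

end Pair

section Pairwise

variable {n : ℕ} {K : Fin n → Type} [∀ i, Field (K i)] [∀ i, NumberField (K i)] [∀ i, IsCMField (K i)]
  {ι : Fin n → Type} [∀ i, Fintype (ι i)] [∀ i, DecidableEq (ι i)] (Φ : ∀ i, CMType (K i)) (μ : ∀ i, Basis (ι i) ℚ (K i))

/-- **Pairwise form, any two members `B_k`, `B_l` of a family of CM tori of CM fields (also `k = l`:
`dim_ℚ End_ℚ(B_k) = #{(s, t) ∈ Hom(K_k, ℂ)² | ∀ τ, τs ∈ Φ_k ⟺ τt ∈ Φ_k}`)**: `rk Hom_ℚ(B_k, B_l) =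
#{(s, t) ∈ Hom(K_k, ℂ) × Hom(K_l, ℂ) | ∀ τ ∈ Aut(ℂ), τs ∈ Φ_k ⟺ τt ∈ Φ_l}` (the `Fin 2` family `(K_k, K_l)`).
[cite: HulekLaface2019PicardNumbersAV, §2.1 Prop. 2.2 (proof) and §1] [cite: GaoUllmo2025, Thm. 3.1] -/
theorem finrank_homRat_periodEquiv_eq_ncard_pairwise (k l : Fin n) :
    finrank ℚ (homRat (periodEquiv (Φ k) (μ k)) (periodEquiv (Φ l) (μ l))) =
      {q : (K k →+* ℂ) × (K l →+* ℂ) |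
        ∀ τ : ℂ ≃+* ℂ, ((τ : ℂ →+* ℂ).comp q.1 ∈ (Φ k).1 ↔ (τ : ℂ →+* ℂ).comp q.2 ∈ (Φ l).1)}.ncard :=
  finrank_homRat_periodEquiv_eq_ncard (K := fun i : Fin 2 => K (![k, l] i)) (fun i => Φ (![k, l] i))
    (fun i => μ (![k, l] i))

/-- **The Picard number of a product of finitely many CM tori of CM fields, explicitly:
`ρ(∏_i B_i) = Σ_i #pohlmannSets Φ_i 1 + Σ_{k<l} #{(s, t) ∈ Hom(K_k, ℂ) × Hom(K_l, ℂ) | ∀ τ, τs ∈ Φ_k ⟺ τt ∈ Φ_l}`**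
(Hulek–Laface's `ρ(∏ X_k) = Σ ρ(X_k) + Σ_{k<l} rk Hom_ℚ(X_k, X_l)` with the single and pairwise counts).
[cite: HulekLaface2019PicardNumbersAV, §2.1 Prop. 2.2 and Cor. 2.3, §1] [cite: GaoUllmo2025, Thm. 3.1] -/
theorem finrank_neronSeveriGroup_sigmaPiPeriod_eq_sum :
    finrank ℤ (neronSeveriGroup (sigmaPiPeriod fun i => periodEquiv (Φ i) (μ i))) =
      ∑ i, (pohlmannSets (Φ i) 1).ncard +
        ∑ l, ∑ k, if k < l then
          {q : (K k →+* ℂ) × (K l →+* ℂ) |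
            ∀ τ : ℂ ≃+* ℂ, ((τ : ℂ →+* ℂ).comp q.1 ∈ (Φ k).1 ↔ (τ : ℂ →+* ℂ).comp q.2 ∈ (Φ l).1)}.ncard
        else 0 := by
  rw [ComplexTorus.finrank_neronSeveriGroup_sigmaPi (fun i => periodEquiv (Φ i) (μ i))
    fun i => CMTypeLattice.isAbelianVariety_periodEquiv (Φ i) (μ i)]
  congr 1
  · exact Finset.sum_congr rfl fun i _ => finrank_neronSeveriGroup_eq_ncard_pohlmannSets (Φ i) (μ i)
  · refine Finset.sum_congr rfl fun l _ => Finset.sum_congr rfl fun k _ => ?_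
    split_ifs
    · exact finrank_homRat_periodEquiv_eq_ncard_pairwise Φ μ k l
    · rfl

/-- **… so `Σ_{k<l} #compatible pairs = #pohlmannSetsAlg Φ 1 − Σ_i #pohlmannSets Φ_i 1`**: the balanced pairs of the CM
algebra `∏_i K_i` beyond the within-slot ones are counted by the pairwise compatible pairs (row g11-#1's
`ρ(∏ B_i) = #pohlmannSetsAlg Φ 1` for the lattices `𝓞`-free or not — any `ℚ`-bases, here `Module.finBasis`; a purely
combinatorial identity, proved through the geometry of `∏_i B_i`). [cite: GaoUllmo2025, Thm. 3.1] [cite: HulekLaface2019PicardNumbersAV, §2.1 Prop. 2.2] -/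
theorem ncard_pohlmannSetsAlg_one_eq_sum :
    (pohlmannSetsAlg Φ 1).ncard =
      ∑ i, (pohlmannSets (Φ i) 1).ncard +
        ∑ l, ∑ k, if k < l then
          {q : (K k →+* ℂ) × (K l →+* ℂ) |
            ∀ τ : ℂ ≃+* ℂ, ((τ : ℂ →+* ℂ).comp q.1 ∈ (Φ k).1 ↔ (τ : ℂ →+* ℂ).comp q.2 ∈ (Φ l).1)}.ncard
        else 0 := by
  rw [← finrank_neronSeveriGroup_sigmaPiPeriod_eq_ncard_pohlmannSetsAlg Φ fun i => Module.finBasis ℚ (K i),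
    finrank_neronSeveriGroup_sigmaPiPeriod_eq_sum Φ fun i => Module.finBasis ℚ (K i)]

end Pairwise

/-! ## §5 Validation `n = 1`: two imaginary quadratic fields (`Hom = 0`, `ρ(E₀ × E₁) = 2` unless `K₀ ≅ K₁`; then
`rk Hom = 2`, `ρ = 4`) -/

section Quadratic

open Literature.NumberTheory.ComplexMultiplication (normalClosure_eq_fieldRange_of_normal finrank_normalClosure_of_normal)
open Literature.NumberTheory.ComplexMultiplication.CMTypeCount (eq_conjugate_of_ne exists_eq_single single single_val
  conjugate_ne_self)

variable {K : Fin 2 → Type} [∀ i, Field (K i)] [∀ i, NumberField (K i)] [∀ i, IsCMField (K i)]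
  {ι : Fin 2 → Type} [∀ i, Fintype (ι i)] [∀ i, DecidableEq (ι i)] (Φ : ∀ i, CMType (K i)) (μ : ∀ i, Basis (ι i) ℚ (K i))

omit [∀ i, IsCMField (K i)] in
/-- **Two NON-isomorphic imaginary quadratic fields have Galois closures in `ℂ` meeting in `ℚ`; in particular complex
conjugation fixes `L₀ ∩ L₁` pointwise** (`L_i = s_i(K_i)` is quadratic; a common irrational element would force
`L₀ = L₀ ∩ L₁ = L₁` by degrees, and `K₀ ≅ s₀(K₀) = s₁(K₁) ≅ K₁`). [cite: Lang2002, V §1 Prop. 1.2 (tower law) and V §3 Thm. 3.3]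
[cite: Shimura1998, §8.4 Example (1)] -/
theorem conj_apply_eq_of_finrank_eq_two (h2 : ∀ i, finrank ℚ (K i) = 2) (hK : IsEmpty (K 0 ≃+* K 1)) (x : ℂ)
    (h₀ : x ∈ IntermediateField.normalClosure ℚ (K 0) ℂ) (h₁ : x ∈ IntermediateField.normalClosure ℚ (K 1) ℂ) :
    starRingEnd ℂ x = x := by
  haveI hq : ∀ i, Algebra.IsQuadraticExtension ℚ (K i) := fun i => ⟨h2 i⟩
  set s : ∀ i, K i →ₐ[ℚ] ℂ := fun i => (Classical.choice (inferInstance : Nonempty (K i →+* ℂ))).toRatAlgHom with hs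
  have hL : ∀ i, IntermediateField.normalClosure ℚ (K i) ℂ = (s i).fieldRange := fun i =>
    normalClosure_eq_fieldRange_of_normal (s i)
  have hfin : ∀ i, finrank ℚ ↥(IntermediateField.normalClosure ℚ (K i) ℂ) = 2 := fun i => by
    rw [finrank_normalClosure_of_normal, h2 i]
  by_contra hx
  set E := IntermediateField.normalClosure ℚ (K 0) ℂ ⊓ IntermediateField.normalClosure ℚ (K 1) ℂ with hE
  have hxE : x ∈ E := ⟨h₀, h₁⟩
  -- `x` is irrational, so `E ≠ ℚ`
  have hE1 : finrank ℚ E ≠ 1 := by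
    intro h1
    rw [IntermediateField.finrank_eq_one_iff] at h1
    rw [h1, IntermediateField.mem_bot] at hxE
    obtain ⟨q, hq⟩ := hxE
    apply hx
    rw [← hq, eq_ratCast]
    exact map_ratCast _ q
  -- `[E : ℚ] ∣ 2`, so `E = L₀` and `E = L₁`
  have hEeq : ∀ i, E = IntermediateField.normalClosure ℚ (K i) ℂ := by
    intro i
    have hle : E ≤ IntermediateField.normalClosure ℚ (K i) ℂ := by
      rcases Fin.exists_fin_two.mp ⟨i, rfl⟩ with rfl | rfl
      exacts [inf_le_left, inf_le_right]
    have hmul := IntermediateField.finrank_bot_mul_relfinrank hle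
    rw [hfin i] at hmul
    have hE2 : finrank ℚ E = 2 := by
      have hdvd : finrank ℚ E ∣ 2 := Dvd.intro _ hmul
      have h12 := (Nat.dvd_prime Nat.prime_two).1 hdvd
      omega
    exact IntermediateField.eq_of_le_of_finrank_le hle (by rw [hfin i, hE2])
  have h01 : (s 0).fieldRange = (s 1).fieldRange := by rw [← hL 0, ← hL 1, ← hEeq 0, ← hEeq 1]
  exact hK.false (((s 0).equivFieldRange.trans (IntermediateField.equivOfEq h01)).trans
    (s 1).equivFieldRange.symm).toRingEquiv

/-- **CM elliptic curves (as CM tori `ℂ/u(𝔪)`) with complex multiplication by NON-isomorphic imaginary quadratic fields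
are `Hom`-orthogonal: `Hom_ℚ(ℂ/u(𝔪₀), ℂ/u(𝔪₁)) = 0`** — the case `n = 1` of §4. [cite: Shimura1998, §8.4 Example (1) and §14.1 Prop. 1]
[cite: Gordon1999HodgeAVSurvey, §3 Theorem (Imai)] [cite: HulekLaface2019PicardNumbersAV, §2.1 Cor. 2.3] -/
theorem finrank_homRat_periodEquiv_eq_zero_of_finrank_eq_two (h2 : ∀ i, finrank ℚ (K i) = 2)
    (hK : IsEmpty (K 0 ≃+* K 1)) :
    finrank ℚ (homRat (periodEquiv (Φ 0) (μ 0)) (periodEquiv (Φ 1) (μ 1))) = 0 :=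
  finrank_homRat_periodEquiv_eq_zero_of_conj_apply_eq Φ μ (conj_apply_eq_of_finrank_eq_two h2 hK)

/-- **… they are not isogenous** (the classical "elliptic curves with CM by different imaginary quadratic fields are not
isogenous"). [cite: Shimura1998, §8.4 Example (1) and §14.1 Prop. 1] [cite: Lange2023AbelianVarietiesComplex, §1.1.2 Cor. 1.1.16] -/
theorem not_isIsogenous_periodEquiv_of_finrank_eq_two (h2 : ∀ i, finrank ℚ (K i) = 2) (hK : IsEmpty (K 0 ≃+* K 1)) :
    ¬ IsIsogenous (periodEquiv (Φ 0) (μ 0)) (periodEquiv (Φ 1) (μ 1)) :=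
  not_isIsogenous_periodEquiv_of_conj_apply_eq Φ μ (conj_apply_eq_of_finrank_eq_two h2 hK)

/-- `ρ(ℂ/u(𝔪)) = 1` for an imaginary quadratic field: one balanced pair `{φ, φ̄}` (a one-dimensional torus is simple and
`ρ = dim` for simple CM tori; read through any lattice, here `Module.finBasis`).
[cite: Lange2023AbelianVarietiesComplex, §2.6.1 Proposition] [cite: Gordon1999HodgeAVSurvey, 9.2.2] -/
theorem ncard_pohlmannSets_one_eq_one_of_finrank_eq_two (h2 : ∀ i, finrank ℚ (K i) = 2) (i : Fin 2) :
    (pohlmannSets (Φ i) 1).ncard = 1 := by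
  rw [← finrank_neronSeveriGroup_eq_ncard_pohlmannSets (Φ i) (Module.finBasis ℚ (K i)),
    finrank_neronSeveriGroup_eq_of_isSimple (Φ i) (Module.finBasis ℚ (K i))
      (ComplexTorus.isSimple_of_card_eq_two _ (by rw [Fintype.card_fin, h2 i])), h2 i]

/-- **`ρ(E₀ × E₁) = 2` for CM elliptic curves with CM by non-isomorphic imaginary quadratic fields** (`= ρ(E₀) + ρ(E₁)`,
Hulek–Laface Cor. 2.3; the minimum value for a product of two elliptic curves).
[cite: HulekLaface2019PicardNumbersAV, §2.1 Cor. 2.3 and §1] [cite: Shimura1998, §8.4 Example (1)] -/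
theorem finrank_neronSeveriGroup_sigmaPiPeriod_eq_two_of_finrank_eq_two (h2 : ∀ i, finrank ℚ (K i) = 2)
    (hK : IsEmpty (K 0 ≃+* K 1)) :
    finrank ℤ (neronSeveriGroup (sigmaPiPeriod fun i => periodEquiv (Φ i) (μ i))) = 2 := by
  rw [finrank_neronSeveriGroup_sigmaPiPeriod_fin_two_eq_add_of_conj_apply_eq Φ μ (conj_apply_eq_of_finrank_eq_two h2 hK),
    ncard_pohlmannSets_one_eq_one_of_finrank_eq_two Φ h2 0, ncard_pohlmannSets_one_eq_one_of_finrank_eq_two Φ h2 1]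

/-- For an imaginary quadratic CM field: `τ ∘ s̄ = s̄ ⟺ τ ∘ s = s` (`τ ∘ s̄ = (τ ∘ s)‾`). [cite: Shimura1998, §8.4 Example (1)] -/
private theorem comp_conjugate_eq_conjugate_iff {L : Type} [Field L] [NumberField L] [IsCMField L] (τ : ℂ ≃+* ℂ)
    (t : L →+* ℂ) :
    (τ : ℂ →+* ℂ).comp (ComplexEmbedding.conjugate t) = ComplexEmbedding.conjugate t ↔ (τ : ℂ →+* ℂ).comp t = t := by
  rw [comp_conjugate_eq']
  exact (ComplexEmbedding.involutive_conjugate L).injective.eq_iff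

/-- For ISOMORPHIC imaginary quadratic fields `e : K₀ ≅ K₁` and embeddings `φ₀`, `φ₁`: `τ` fixes `φ₀` iff it fixes `φ₁`
(`φ₁ ∘ e ∈ {φ₀, φ̄₀}` and `τφ̄₀ = φ̄₀ ⟺ τφ₀ = φ₀`). [cite: Shimura1998, §8.4 Example (1)] -/
private theorem comp_eq_self_iff_of_ringEquiv (h2 : ∀ i, finrank ℚ (K i) = 2) (e : K 0 ≃+* K 1)
    (φ₀ : K 0 →+* ℂ) (φ₁ : K 1 →+* ℂ) (τ : ℂ ≃+* ℂ) :
    (τ : ℂ →+* ℂ).comp φ₀ = φ₀ ↔ (τ : ℂ →+* ℂ).comp φ₁ = φ₁ := by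
  -- transport `φ₁` to `K₀`
  have key : (τ : ℂ →+* ℂ).comp φ₁ = φ₁ ↔ (τ : ℂ →+* ℂ).comp (φ₁.comp e.toRingHom) = φ₁.comp e.toRingHom := by
    constructor
    · intro h
      rw [← RingHom.comp_assoc, h]
    · intro h
      refine RingHom.ext fun y => ?_
      have := RingHom.congr_fun h (e.symm y)
      simpa using this
  rw [key]
  rcases eq_or_ne (φ₁.comp e.toRingHom) φ₀ with h | h
  · rw [h]
  · rw [eq_conjugate_of_ne (h2 0) h, comp_conjugate_eq_conjugate_iff]

/-- **For ISOMORPHIC imaginary quadratic fields the compatible pairs are exactly `(φ₀, φ₁)` and `(φ̄₀, φ̄₁)`**, where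
`Φ_i = {φ_i}`: two of them. [cite: Shimura1998, §8.4 Example (1)] [cite: Gordon1999HodgeAVSurvey, 9.2.2] -/
theorem ncard_compatiblePairs_eq_two_of_finrank_eq_two (h2 : ∀ i, finrank ℚ (K i) = 2) (e : K 0 ≃+* K 1) :
    {q : (K 0 →+* ℂ) × (K 1 →+* ℂ) |
        ∀ τ : ℂ ≃+* ℂ, ((τ : ℂ →+* ℂ).comp q.1 ∈ (Φ 0).1 ↔ (τ : ℂ →+* ℂ).comp q.2 ∈ (Φ 1).1)}.ncard = 2 := by
  obtain ⟨φ₀, hΦ₀⟩ := exists_eq_single (h2 0) (Φ 0)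
  obtain ⟨φ₁, hΦ₁⟩ := exists_eq_single (h2 1) (Φ 1)
  -- every `τ` moves an embedding to itself or to its conjugate
  have hdich : ∀ (i : Fin 2) (τ : ℂ ≃+* ℂ) (φ : K i →+* ℂ),
      (τ : ℂ →+* ℂ).comp φ = φ ∨ (τ : ℂ →+* ℂ).comp φ = ComplexEmbedding.conjugate φ := fun i τ φ => by
    rcases eq_or_ne ((τ : ℂ →+* ℂ).comp φ) φ with h | h
    exacts [Or.inl h, Or.inr (eq_conjugate_of_ne (h2 i) h)]
  have hconjmem : ∀ (i : Fin 2) (τ : ℂ ≃+* ℂ) (φ : K i →+* ℂ),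
      ((τ : ℂ →+* ℂ).comp (ComplexEmbedding.conjugate φ) = φ ↔ ¬ (τ : ℂ →+* ℂ).comp φ = φ) := fun i τ φ => by
    rw [comp_conjugate_eq']
    constructor
    · intro h h'
      rw [h'] at h
      exact conjugate_ne_self φ h
    · intro h
      rcases hdich i τ φ with h' | h'
      · exact absurd h' h
      · rw [h', ComplexEmbedding.involutive_conjugate (K i) φ]
  have hset : {q : (K 0 →+* ℂ) × (K 1 →+* ℂ) |
        ∀ τ : ℂ ≃+* ℂ, ((τ : ℂ →+* ℂ).comp q.1 ∈ (Φ 0).1 ↔ (τ : ℂ →+* ℂ).comp q.2 ∈ (Φ 1).1)} =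
      {(φ₀, φ₁), (ComplexEmbedding.conjugate φ₀, ComplexEmbedding.conjugate φ₁)} := by
    ext ⟨u, v⟩
    simp only [hΦ₀, hΦ₁, single_val, Set.mem_singleton_iff, Set.mem_setOf_eq, Set.mem_insert_iff, Prod.mk.injEq]
    constructor
    · intro h
      have h1 := h 1
      have e₁ : ((1 : ℂ ≃+* ℂ) : ℂ →+* ℂ).comp u = u := RingHom.ext fun _ => rfl
      have e₂ : ((1 : ℂ ≃+* ℂ) : ℂ →+* ℂ).comp v = v := RingHom.ext fun _ => rfl
      rw [e₁, e₂] at h1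
      rcases eq_or_ne u φ₀ with hu | hu
      · exact Or.inl ⟨hu, h1.1 hu⟩
      · refine Or.inr ⟨eq_conjugate_of_ne (h2 0) hu, eq_conjugate_of_ne (h2 1) fun hv => hu (h1.2 hv)⟩
    · rintro (⟨rfl, rfl⟩ | ⟨rfl, rfl⟩) τ
      · exact comp_eq_self_iff_of_ringEquiv h2 e u v τ
      · rw [hconjmem 0 τ φ₀, hconjmem 1 τ φ₁, comp_eq_self_iff_of_ringEquiv h2 e φ₀ φ₁ τ]
  rw [hset, Set.ncard_pair]
  intro h
  exact conjugate_ne_self φ₀ (Prod.mk.inj h).1.symm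

/-- **`rk Hom_ℚ(ℂ/u(𝔪₀), ℂ/u(𝔪₁)) = 2` for ISOMORPHIC imaginary quadratic fields** (`= [K : ℚ]`: `Hom_ℚ ≅ K`, Shimura
§7.4 Prop. 15 / §14.1 Prop. 1 for `n = 1`). [cite: Shimura1998, §7.4 Prop. 15, §14.1 Prop. 1 and §8.4 Example (1)]
[cite: HulekLaface2019PicardNumbersAV, §2.1 Prop. 2.2] -/
theorem finrank_homRat_periodEquiv_eq_two_of_finrank_eq_two (h2 : ∀ i, finrank ℚ (K i) = 2) (e : K 0 ≃+* K 1) :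
    finrank ℚ (homRat (periodEquiv (Φ 0) (μ 0)) (periodEquiv (Φ 1) (μ 1))) = 2 := by
  rw [finrank_homRat_periodEquiv_eq_ncard, ncard_compatiblePairs_eq_two_of_finrank_eq_two Φ h2 e]

/-- **`ρ(E₀ × E₁) = 4` for CM elliptic curves with CM by ISOMORPHIC imaginary quadratic fields** (`1 + 1 + 2`; the maximal
Picard number `ρ = h^{1,1}` of an abelian surface). [cite: HulekLaface2019PicardNumbersAV, §2.1 Prop. 2.2 and §1]
[cite: Shimura1998, §8.4 Example (1)] -/
theorem finrank_neronSeveriGroup_sigmaPiPeriod_eq_four_of_finrank_eq_two (h2 : ∀ i, finrank ℚ (K i) = 2)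
    (e : K 0 ≃+* K 1) :
    finrank ℤ (neronSeveriGroup (sigmaPiPeriod fun i => periodEquiv (Φ i) (μ i))) = 4 := by
  rw [finrank_neronSeveriGroup_sigmaPiPeriod_fin_two_eq, ncard_pohlmannSets_one_eq_one_of_finrank_eq_two Φ h2 0,
    ncard_pohlmannSets_one_eq_one_of_finrank_eq_two Φ h2 1, ncard_compatiblePairs_eq_two_of_finrank_eq_two Φ h2 e]

end Quadratic

end CMTorus

end Literature.AlgebraicGeometry.ComplexMultiplication

end
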